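import Summits.Ventures.LatticeQCDFlow.Scaling.HubChainPerStepDomination

/-!
HONEST FRAMING: exact (Metropolis-corrected) sampling algorithms for lattice gauge theory; figures
of merit are autocorrelation/cost numbers at stated couplings and volumes; no continuum-physics
claim.

# HubChainStartContentCover — THE START-CLASS DEFICIT IS COVERED, STEP BY STEP, BY THE TAG'S OWN OCCUPATION: `P_Yⁿ(i,i) ≤ P_Xⁿ(i,i) + P_Xⁿ(i,s)` FOR A START CLASS `i`
# DEEPER THAN THE TAG RANK `s` (SORTED LOCAL FORM), BY A FIRST-STEP INDUCTION THROUGH CONJECTURE M′ AND A PARITY ESTIMATE AT THE START CLASS (lean-2 GEN-40, ours)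

Venture-side (OURS).  Cell `lqcd-flow` (pub-lqcd), unit `pub-lqcd-lean-2-g40`, 2026-08-30.  Chapter Z, file 6.  Setting of Z2 (class chain; two sorted depth profiles agreeing off the tag
rank `s`, `ρ^X_s ≤ ρ^Y_s`; kernels and powers of Y7∕Y8 for both; weights `N ≥ 1`, `cM_0 ≤ 1 + c`).  Route (β) pays for the `j`-attempt laws' defect at the start class (Z5: the parity term);
here it is bounded by what the SAME step gives back, `X`'s occupation of its tag.  `cover_T_ge_first`, `cover_T_sub_ge_deep` (Z2's comparison with the rank-`j` term kept),
`cover_beta_add_r_nonneg` (`β^X_i + cN_sρ^X_s/ρ_i ≥ 0`: a negative eigenvalue at the start class is at most the tag's share of the shallower mass), `cover_H_ge_pow`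
(`H_n(−t,a) ≥ tⁿ⁻¹`, odd `n`) give `cover_I`: `P_Yⁿ(s,i) ≤ P_Xⁿ(i,i) + P_Xⁿ(i,s)` (even `n` termwise, odd `n` by the two estimates) and `cover_II`: `P_Yⁿ(s,i) ≤ P_Xⁿ(s,i) + P_Xⁿ(s,s)`;
`startClass_cover_of` is the first-step induction (staying: induction; to an ordinary class: M′; to the tag: `(I)`∕`(II)`; `X`'s surplus holding probability `P_X(i,i) − P_Y(i,i) =
P_Y(i,s) − P_X(i,s) ≥ 0` pays the difference), and **`startClass_cover`: for `s < i < m` (three particles at ranks `≤ i`): `P_Yⁿ(i,i) ≤ P_Xⁿ(i,i) + P_Xⁿ(i,s)` for every `n`.**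
So per attempt count the start-content deficit `(y_j(ζ) − x_j(ζ))⁺` is at most `x_j(★)` (and `0` for odd `j`, Z5): `D ≤ Σ_{j even}w_j·min{x_j(★), K⁻ʲ}` for adjacent pairs whose tags are
not separated by another class (the GLOBAL form is toy-true and open, MEMO-gen40 §5).  TOY (`numerics/sigma_toy.py`, `ineqI_toy.py`, exact rationals, NOTHING CLAIMED): 0 ∕ 38 080 and
0 ∕ 7 172 violations; the bound is attained in the limit family of the memo.  Literature grade (cell rule): OWN, elementary; nothing cited; no new bib keys.
-/

open Finset

namespace Summit.Ventures.LatticeQCDFlow.Scaling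

/-! ### §1 Powers from the left, non-negativity -/
section CoverPow
variable {m : ℕ} {ρ N R M β a : ℕ → ℝ} {c : ℝ} {P f : ℕ → ℕ → ℝ} {Pn : ℕ → ℕ → ℕ → ℝ} {T : ℕ → ℕ → ℝ} {H : ℕ → ℝ → ℝ → ℝ}

/-- **`Pⁿ⁺¹ = P·Pⁿ`** on the ranks `< m`, from the right recursion `Pⁿ⁺¹ = PⁿP`. [ours] -/
theorem cover_pow_left (hP0 : ∀ i j, Pn 0 i j = if i = j then 1 else 0) (hPs : ∀ n i j, Pn (n + 1) i j = ∑ l ∈ range m, Pn n i l * P l j) :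
    ∀ n {i j : ℕ}, i < m → j < m → Pn (n + 1) i j = ∑ l ∈ range m, P i l * Pn n l j := by
  intro n
  induction n with
  | zero =>
      intro i j hi hj
      rw [hPs]
      have h1 : ∑ l ∈ range m, Pn 0 i l * P l j = P i j := by
        rw [Finset.sum_eq_single i (fun l _ hl => by rw [hP0, if_neg (Ne.symm hl), zero_mul]) (fun h => absurd (mem_range.mpr hi) h), hP0, if_pos rfl, one_mul]
      have h2 : ∑ l ∈ range m, P i l * Pn 0 l j = P i j := by
        rw [Finset.sum_eq_single j (fun l _ hl => by rw [hP0, if_neg hl, mul_zero]) (fun h => absurd (mem_range.mpr hj) h), hP0, if_pos rfl, mul_one]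
      rw [h1, h2]
  | succ n ih =>
      intro i j hi hj
      rw [hPs]
      calc ∑ l ∈ range m, Pn (n + 1) i l * P l j = ∑ l ∈ range m, ∑ k ∈ range m, P i k * Pn n k l * P l j :=
            sum_congr rfl fun l hl => by rw [ih hi (mem_range.mp hl), sum_mul]
        _ = ∑ k ∈ range m, ∑ l ∈ range m, P i k * Pn n k l * P l j := sum_comm
        _ = ∑ k ∈ range m, P i k * ∑ l ∈ range m, Pn n k l * P l j := sum_congr rfl fun k _ => by rw [mul_sum]; exact sum_congr rfl fun l _ => by ring
        _ = ∑ k ∈ range m, P i k * Pn (n + 1) k j := sum_congr rfl fun k _ => by rw [← hPs]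

/-- The kernel is entrywise non-negative on the rows `< m` (`c ≥ 0`, `N ≥ 1`, `cM_0 ≤ 1 + c`). [ours] -/
theorem cover_P_nonneg (hρ : ∀ i, 0 < ρ i) (hmono : Monotone ρ) (hN : ∀ i, 0 < N i) (hN1 : ∀ i, 1 ≤ N i) (hR : ∀ k, R k = ∑ i ∈ range k, N i * ρ i)
    (hM : ∀ k, M k = ∑ i ∈ Ico k m, N i)
    (hPoff : ∀ i j, i ≠ j → P i j = c * N j * min 1 (ρ j / ρ i)) (hPdiag : ∀ i, P i i = 1 - ∑ j ∈ (range m).erase i, P i j)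
    (hβ : ∀ k, β k = 1 - c * (M k + R k / ρ k)) (hc : 0 ≤ c) (hcK : c * M 0 ≤ 1 + c) {l : ℕ} (hl : l < m) (j : ℕ) : 0 ≤ P l j := by
  by_cases hlj : l = j
  · subst hlj
    refine hubClass_diag_nonneg hρ hmono hN hR hM hPoff hPdiag hβ hc hl ?_
    nlinarith [hN1 l]
  · rw [hPoff l j hlj]
    exact mul_nonneg (mul_nonneg hc (hN j).le) (le_min zero_le_one (div_pos (hρ j) (hρ l)).le)

/-- The powers are entrywise non-negative. [ours] -/
theorem cover_pow_nonneg (hP0 : ∀ i j, Pn 0 i j = if i = j then 1 else 0) (hPs : ∀ n i j, Pn (n + 1) i j = ∑ l ∈ range m, Pn n i l * P l j)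
    (hPnn : ∀ l, l < m → ∀ j, 0 ≤ P l j) : ∀ n i j, 0 ≤ Pn n i j := by
  intro n
  induction n with
  | zero => intro i j; rw [hP0]; split_ifs <;> norm_num
  | succ n ih => intro i j; rw [hPs]; exact sum_nonneg fun l hl => mul_nonneg (ih i l) (hPnn l (mem_range.mp hl) j)

/-- The level at a rank with another rank below it is non-negative: `k < j < m`, `N ≥ 1`, `cM_0 ≤ 1 + c` ⇒ `a_j ≥ 0`. [ours] -/
theorem cover_a_nonneg (hN : ∀ i, 0 < N i) (hN1 : ∀ i, 1 ≤ N i) (hM : ∀ k, M k = ∑ i ∈ Ico k m, N i) (ha : ∀ l, a l = 1 - c * M (l + 1)) (hc : 0 ≤ c)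
    (hcK : c * M 0 ≤ 1 + c) {k j : ℕ} (hkj : k < j) (hj : j < m) : 0 ≤ a j := by
  have hsplit : M 0 = ∑ l ∈ range (j + 1), N l + M (j + 1) := by
    rw [hM, hM, ← Finset.range_eq_Ico]; exact (Finset.sum_range_add_sum_Ico _ (by omega : j + 1 ≤ m)).symm
  have hsub : ({k, j} : Finset ℕ) ⊆ range (j + 1) := by
    intro x hx; simp only [mem_insert, mem_singleton] at hx
    rcases hx with rfl | rfl <;> exact mem_range.mpr (by omega)
  have hge : N k + N j ≤ ∑ l ∈ range (j + 1), N l := by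
    have h := sum_le_sum_of_subset_of_nonneg hsub (fun l _ _ => (hN l).le)
    rw [sum_insert (by simp; omega), sum_singleton] at h; exact h
  rw [ha]
  nlinarith [hN1 k, hN1 j, mul_nonneg hc (show 0 ≤ ∑ l ∈ range (j + 1), N l - 2 by linarith [hN1 k, hN1 j])]

/-- **`T_n(j) ≥ cW_jH_n(β_j,a_j)`**: the deeper rank terms of the separable form are non-negative (three particles at ranks `≤ j+1`, and a rank below `j`). [ours] -/
theorem cover_T_ge_first (hρ : ∀ i, 0 < ρ i) (hmono : Monotone ρ) (hN : ∀ i, 0 < N i) (hR : ∀ k, R k = ∑ i ∈ range k, N i * ρ i)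
    (hM : ∀ k, M k = ∑ i ∈ Ico k m, N i) (hβ : ∀ k, β k = 1 - c * (M k + R k / ρ k)) (ha : ∀ l, a l = 1 - c * M (l + 1))
    (hT : ∀ n j, T n j = (1 - β j ^ n) / R m + ∑ k ∈ Ico (j + 1) m, (1 / R k - 1 / R (k + 1)) * (β k ^ n - β j ^ n))
    (hH : ∀ n x y, H n x y = ∑ t ∈ range n, x ^ t * y ^ (n - 1 - t))
    (hc : 0 ≤ c) (hcK : c * M 0 ≤ 1 + c) (n : ℕ) {j : ℕ} (hj : j < m) (ha0 : 0 ≤ a j) (h3 : M (j + 2) + 3 ≤ M 0) :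
    c * (1 / ρ j) * H n (β j) (a j) ≤ T n j := by
  obtain ⟨G, hG⟩ : ∃ G : ℕ → ℝ → ℝ → ℝ → ℝ, ∀ n a a' b, G n a a' b = ∑ q ∈ range (n - 1), a' ^ q * H (n - 1 - q) b a := ⟨_, fun _ _ _ _ => rfl⟩
  rw [hubClass_T_separable hρ hN hR hM hβ ha hT hH n hj]
  have hal : ∀ l, j + 1 ≤ l → 2 * c ≤ a l := fun l hjl => perStep_level hN hM ha hc hcK h3 hjl
  have hapos : ∀ l, j + 1 ≤ l → 0 < a l := by
    intro l hjl
    have := hal l hjl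
    rcases hc.eq_or_lt with h0 | hpos; · rw [ha, ← h0]; norm_num
    linarith
  have hann : ∀ l, j ≤ l → 0 ≤ a l := by
    intro l hjl
    rcases Nat.eq_or_lt_of_le hjl with h | h
    · rw [← h]; exact ha0
    · linarith [hal l (by omega)]
  have hsum : 0 ≤ ∑ l ∈ Ico (j + 1) m, (1 / ρ l) * (H n (β l) (a l) - H n (β l) (a (l - 1))) := by
    refine sum_nonneg fun l hl => ?_
    have hl' : j + 1 ≤ l ∧ l < m := by simpa using mem_Ico.mp hl
    rw [← sepG_mul hH hG n (a l) (a (l - 1)) (β l), sep_a_step hM ha (by omega) hl'.2]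
    exact mul_nonneg (div_nonneg zero_le_one (hρ l).le) (mul_nonneg (mul_nonneg hc (hN l).le)
      (sepG_nonneg hH hG n (hapos l hl'.1) (hann (l - 1) (by omega)) (perStep_beta_level hρ hmono hN hR hM hβ ha hc hcK h3 hl'.1 hl'.2)))
  nlinarith [mul_nonneg hc hsum]

end CoverPow
/-! ### §2 The two estimates at a deep start class -/
section CoverEst
variable {m s : ℕ} {ρX ρY N RX RY M βX βY a : ℕ → ℝ} {c : ℝ} {PX PY fX fY : ℕ → ℕ → ℝ} {PnX PnY : ℕ → ℕ → ℕ → ℝ} {TX TY : ℕ → ℕ → ℝ}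
  {H : ℕ → ℝ → ℝ → ℝ}

/-- **Z2's comparison with the rank-`j` term kept:** for `s < j`, `T^X_n(j) − T^Y_n(j) ≥ c(1/ρ_j)[H_n(β^X_j,a_j) − H_n(β^Y_j,a_j)]`. [ours] -/
theorem cover_T_sub_ge_deep (hρX : ∀ i, 0 < ρX i) (hρY : ∀ i, 0 < ρY i) (hmonoY : Monotone ρY)
    (hagree : ∀ i, i ≠ s → ρX i = ρY i) (htag : ρX s ≤ ρY s) (hN : ∀ i, 0 < N i)
    (hRX : ∀ k, RX k = ∑ i ∈ range k, N i * ρX i) (hRY : ∀ k, RY k = ∑ i ∈ range k, N i * ρY i) (hM : ∀ k, M k = ∑ i ∈ Ico k m, N i)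
    (hβX : ∀ k, βX k = 1 - c * (M k + RX k / ρX k)) (hβY : ∀ k, βY k = 1 - c * (M k + RY k / ρY k)) (ha : ∀ l, a l = 1 - c * M (l + 1))
    (hTX : ∀ n j, TX n j = (1 - βX j ^ n) / RX m + ∑ k ∈ Ico (j + 1) m, (1 / RX k - 1 / RX (k + 1)) * (βX k ^ n - βX j ^ n))
    (hTY : ∀ n j, TY n j = (1 - βY j ^ n) / RY m + ∑ k ∈ Ico (j + 1) m, (1 / RY k - 1 / RY (k + 1)) * (βY k ^ n - βY j ^ n))
    (hH : ∀ n x y, H n x y = ∑ t ∈ range n, x ^ t * y ^ (n - 1 - t))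
    (hc : 0 ≤ c) (hcK : c * M 0 ≤ 1 + c) (n : ℕ) {j : ℕ} (hsj : s < j) (hj : j < m) (ha0 : 0 ≤ a j) (h3 : M (j + 2) + 3 ≤ M 0) :
    c * (1 / ρX j) * (H n (βX j) (a j) - H n (βY j) (a j)) ≤ TX n j - TY n j := by
  obtain ⟨G, hG⟩ : ∃ G : ℕ → ℝ → ℝ → ℝ → ℝ, ∀ n a a' b, G n a a' b = ∑ q ∈ range (n - 1), a' ^ q * H (n - 1 - q) b a := ⟨_, fun _ _ _ _ => rfl⟩
  have hρj : ρX j = ρY j := hagree j (by omega)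
  rw [hubClass_T_separable hρX hN hRX hM hβX ha hTX hH n hj, hubClass_T_separable hρY hN hRY hM hβY ha hTY hH n hj, ← hρj]
  have hal : ∀ l, j + 1 ≤ l → 2 * c ≤ a l := fun l hjl => perStep_level hN hM ha hc hcK h3 hjl
  have hapos : ∀ l, j + 1 ≤ l → 0 < a l := by
    intro l hjl
    have := hal l hjl
    rcases hc.eq_or_lt with h0 | hpos; · rw [ha, ← h0]; norm_num
    linarith
  have hann : ∀ l, j ≤ l → 0 ≤ a l := by
    intro l hjl
    rcases Nat.eq_or_lt_of_le hjl with h | h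
    · rw [← h]; exact ha0
    · linarith [hal l (by omega)]
  have hβYl : ∀ l, j + 1 ≤ l → l < m → 0 ≤ a l + 2 * βY l := fun l hjl hl => perStep_beta_level hρY hmonoY hN hRY hM hβY ha hc hcK h3 hjl hl
  have hβle : ∀ l, s < l → βY l ≤ βX l := fun l hsl => perStep_beta_le hρY hagree htag hN hRX hRY hβX hβY hc hsl
  have h2 : ∑ l ∈ Ico (j + 1) m, (1 / ρY l) * (H n (βY l) (a l) - H n (βY l) (a (l - 1)))
      ≤ ∑ l ∈ Ico (j + 1) m, (1 / ρX l) * (H n (βX l) (a l) - H n (βX l) (a (l - 1))) := by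
    refine sum_le_sum fun l hl => ?_
    have hl' : j + 1 ≤ l ∧ l < m := by simpa using mem_Ico.mp hl
    rw [← hagree l (by omega), ← sepG_mul hH hG n (a l) (a (l - 1)) (βY l), ← sepG_mul hH hG n (a l) (a (l - 1)) (βX l), sep_a_step hM ha (by omega) hl'.2]
    have hGle := sepG_mono hH hG n (a' := a (l - 1)) (hapos l hl'.1) (hann (l - 1) (by omega)) (hβYl l hl'.1 hl'.2) (hβle l (by omega))
    exact mul_le_mul_of_nonneg_left (mul_le_mul_of_nonneg_left hGle (mul_nonneg hc (hN l).le)) (div_nonneg zero_le_one (hρX l).le)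
  nlinarith [mul_le_mul_of_nonneg_left h2 hc]

/-- **A negative eigenvalue at a deep start class is at most the tag's share:** for `s < i`, `β^X_i + cN_sρ^X_s/ρ^X_i ≥ 0` (the other shallower classes weigh at most `ρ_i` each, `N_s ≥ 1`,
`cM_0 ≤ 1 + c`). [ours] -/
theorem cover_beta_add_r_nonneg (hρX : ∀ i, 0 < ρX i) (hmonoX : Monotone ρX) (hN : ∀ i, 0 < N i) (hN1 : ∀ i, 1 ≤ N i)
    (hRX : ∀ k, RX k = ∑ i ∈ range k, N i * ρX i) (hM : ∀ k, M k = ∑ i ∈ Ico k m, N i)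
    (hβX : ∀ k, βX k = 1 - c * (M k + RX k / ρX k)) (hc : 0 ≤ c) (hcK : c * M 0 ≤ 1 + c) {i : ℕ} (hsi : s < i) (hi : i < m) :
    0 ≤ βX i + c * N s * ρX s / ρX i := by
  have hρi := hρX i
  have hRsplit : RX i = N s * ρX s + ∑ l ∈ (range i).erase s, N l * ρX l := by
    rw [hRX, ← Finset.add_sum_erase _ _ (mem_range.mpr hsi)]
  have hrest : ∑ l ∈ (range i).erase s, N l * ρX l ≤ (∑ l ∈ (range i).erase s, N l) * ρX i := by
    rw [sum_mul]
    exact sum_le_sum fun l hl => mul_le_mul_of_nonneg_left (hmonoX (by have := mem_range.mp (mem_of_mem_erase hl); omega)) (hN l).le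
  have hMsplit : M 0 = (∑ l ∈ range i, N l) + M i := by
    rw [hM, hM, ← Finset.range_eq_Ico]
    exact (Finset.sum_range_add_sum_Ico _ hi.le).symm
  have hNsplit : ∑ l ∈ range i, N l = N s + ∑ l ∈ (range i).erase s, N l := by rw [← Finset.add_sum_erase _ _ (mem_range.mpr hsi)]
  have h1 : RX i / ρX i ≤ N s * ρX s / ρX i + ∑ l ∈ (range i).erase s, N l := by
    rw [hRsplit, add_div]
    have : (∑ l ∈ (range i).erase s, N l * ρX l) / ρX i ≤ ∑ l ∈ (range i).erase s, N l := by rw [div_le_iff₀ hρi]; exact hrest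
    linarith
  have hS : ∑ l ∈ (range i).erase s, N l = M 0 - M i - N s := by rw [hMsplit, hNsplit]; ring
  have hkey : c * (RX i / ρX i) ≤ c * (N s * ρX s / ρX i) + c * (M 0 - M i - N s) := by
    have := mul_le_mul_of_nonneg_left h1 hc
    rw [hS, mul_add] at this
    exact this
  have hcNs : c ≤ c * N s := le_mul_of_one_le_right hc (hN1 s)
  have e1 : c * (M i + RX i / ρX i) = c * M i + c * (RX i / ρX i) := by ring
  rw [hβX, show c * N s * ρX s / ρX i = c * (N s * ρX s / ρX i) by ring]
  linarith [hkey, hcK, hcNs, e1, show c * (M 0 - M i - N s) = c * M 0 - c * M i - c * N s by ring]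

/-- For odd `n` and `a ≥ t ≥ 0`: `H_n(−t,a) ≥ tⁿ⁻¹` (from `(a+t)H_n(−t,a) = aⁿ + tⁿ`). [ours] -/
theorem cover_H_ge_pow (hH : ∀ n x y, H n x y = ∑ t ∈ range n, x ^ t * y ^ (n - 1 - t)) {n : ℕ} (hn : Odd n) {t a : ℝ} (ht : 0 ≤ t) (hta : t ≤ a) (ha : 0 < a) :
    t ^ (n - 1) ≤ H n (-t) a := by
  have hmul := hubChain_H_mul hH n (-t) a
  rw [hn.neg_pow] at hmul
  obtain ⟨k, hk⟩ := hn
  have hn1 : n - 1 + 1 = n := by omega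
  have hpow : a * t ^ (n - 1) ≤ a ^ n := by
    calc a * t ^ (n - 1) ≤ a * a ^ (n - 1) := mul_le_mul_of_nonneg_left (pow_le_pow_left₀ ht hta _) ha.le
      _ = a ^ n := by rw [← pow_succ', hn1]
  have htn : t * t ^ (n - 1) = t ^ n := by rw [← pow_succ', hn1]
  have hat : 0 < a + t := by linarith
  rw [← sub_nonneg]
  have : (H n (-t) a - t ^ (n - 1)) * (a + t) = a ^ n - a * t ^ (n - 1) := by nlinarith [hmul, htn]
  nlinarith [this, hpow]

/-- **(I): from `Y`'s tag, reaching the start class is no likelier than `X`, from the start class, being at the start class or at its tag:** for `s < i`,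
`P_Yⁿ(s,i) ≤ P_Xⁿ(i,i) + P_Xⁿ(i,s)`. [ours] -/
theorem cover_I (hρX : ∀ i, 0 < ρX i) (hmonoX : Monotone ρX) (hρY : ∀ i, 0 < ρY i) (hmonoY : Monotone ρY)
    (hagree : ∀ i, i ≠ s → ρX i = ρY i) (htag : ρX s ≤ ρY s) (hN : ∀ i, 0 < N i) (hN1 : ∀ i, 1 ≤ N i)
    (hRX : ∀ k, RX k = ∑ i ∈ range k, N i * ρX i) (hRY : ∀ k, RY k = ∑ i ∈ range k, N i * ρY i) (hM : ∀ k, M k = ∑ i ∈ Ico k m, N i)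
    (hPXoff : ∀ i j, i ≠ j → PX i j = c * N j * min 1 (ρX j / ρX i)) (hPXdiag : ∀ i, PX i i = 1 - ∑ j ∈ (range m).erase i, PX i j)
    (hPYoff : ∀ i j, i ≠ j → PY i j = c * N j * min 1 (ρY j / ρY i)) (hPYdiag : ∀ i, PY i i = 1 - ∑ j ∈ (range m).erase i, PY i j)
    (hfX : ∀ k i, fX k i = if i < k then ρX k else if i = k then -(RX k / N k) else 0)
    (hfY : ∀ k i, fY k i = if i < k then ρY k else if i = k then -(RY k / N k) else 0)
    (hβX : ∀ k, βX k = 1 - c * (M k + RX k / ρX k)) (hβY : ∀ k, βY k = 1 - c * (M k + RY k / ρY k)) (ha : ∀ l, a l = 1 - c * M (l + 1))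
    (hPX0 : ∀ i j, PnX 0 i j = if i = j then 1 else 0) (hPXs : ∀ n i j, PnX (n + 1) i j = ∑ l ∈ range m, PnX n i l * PX l j)
    (hPY0 : ∀ i j, PnY 0 i j = if i = j then 1 else 0) (hPYs : ∀ n i j, PnY (n + 1) i j = ∑ l ∈ range m, PnY n i l * PY l j)
    (hTX : ∀ n j, TX n j = (1 - βX j ^ n) / RX m + ∑ k ∈ Ico (j + 1) m, (1 / RX k - 1 / RX (k + 1)) * (βX k ^ n - βX j ^ n))
    (hTY : ∀ n j, TY n j = (1 - βY j ^ n) / RY m + ∑ k ∈ Ico (j + 1) m, (1 / RY k - 1 / RY (k + 1)) * (βY k ^ n - βY j ^ n))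
    (hc : 0 ≤ c) (hcK : c * M 0 ≤ 1 + c) (n : ℕ) {i : ℕ} (hsi : s < i) (hi : i < m) (h3 : M (i + 1) + 3 ≤ M 0) :
    PnY n s i ≤ PnX n i i + PnX n i s := by
  obtain ⟨H, hH⟩ : ∃ H : ℕ → ℝ → ℝ → ℝ, ∀ n x y, H n x y = ∑ t ∈ range n, x ^ t * y ^ (n - 1 - t) := ⟨_, fun _ _ _ => rfl⟩
  have hs : s < m := hsi.trans hi
  rw [hubClass_pow_offdiag hρY hmonoY hN hRY hM hPYoff hPYdiag hfY hβY hPY0 hPYs hTY n hs hi (by omega), max_eq_right hsi.le, ← hagree i (by omega),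
    hubClass_pow_diag hρX hmonoX hN hRX hM hPXoff hPXdiag hfX hβX hPX0 hPXs hTX n hi,
    hubClass_pow_offdiag hρX hmonoX hN hRX hM hPXoff hPXdiag hfX hβX hPX0 hPXs hTX n hi hs (by omega), max_eq_left hsi.le]
  have ha0 : 0 ≤ a i := cover_a_nonneg hN hN1 hM ha hc hcK hsi hi
  have h3' : M (i + 2) + 3 ≤ M 0 := by linarith [perStep_M_anti hN hM (by omega : i + 1 ≤ i + 2)]
  have hsub := cover_T_sub_ge_deep hρX hρY hmonoY hagree htag hN hRX hRY hM hβX hβY ha hTX hTY hH hc hcK n hsi hi ha0 h3'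
  have hfirst := cover_T_ge_first hρX hmonoX hN hRX hM hβX ha hTX hH hc hcK n hi ha0 h3'
  have hapos : 0 < a i := by
    have := perStep_level hN hM ha hc hcK h3 le_rfl
    rcases hc.eq_or_lt with h0 | hpos; · rw [ha, ← h0]; norm_num
    linarith
  have hβXl : 0 ≤ a i + 2 * βX i := perStep_beta_level hρX hmonoX hN hRX hM hβX ha hc hcK h3 le_rfl hi
  have hβYl : 0 ≤ a i + 2 * βY i := perStep_beta_level hρY hmonoY hN hRY hM hβY ha hc hcK h3 le_rfl hi
  have hβle : βY i ≤ βX i := perStep_beta_le hρY hagree htag hN hRX hRY hβX hβY hc hsi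
  have hHmono : H n (βY i) (a i) ≤ H n (βX i) (a i) := sepH_mono hH n hapos hβYl hβle
  have hHnn : 0 ≤ H n (βX i) (a i) := sepH_nonneg hH n hapos hβXl
  have hρi := hρX i
  have hA : c * N i * (H n (βX i) (a i) - H n (βY i) (a i)) ≤ N i * ρX i * (TX n i - TY n i) := by
    have := mul_le_mul_of_nonneg_left hsub (mul_nonneg (hN i).le (hρX i).le)
    have e : N i * ρX i * (c * (1 / ρX i) * (H n (βX i) (a i) - H n (βY i) (a i))) = c * N i * (H n (βX i) (a i) - H n (βY i) (a i)) := by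
      field_simp
    linarith [this, e]
  have hB : c * N s * ρX s / ρX i * H n (βX i) (a i) ≤ N s * ρX s * TX n i := by
    have := mul_le_mul_of_nonneg_left hfirst (mul_nonneg (hN s).le (hρX s).le)
    have e : N s * ρX s * (c * (1 / ρX i) * H n (βX i) (a i)) = c * N s * ρX s / ρX i * H n (βX i) (a i) := by field_simp
    linarith [this, e]
  have hC : 0 ≤ βX i ^ n + c * N s * ρX s / ρX i * H n (βX i) (a i) := by
    have hr := cover_beta_add_r_nonneg hρX hmonoX hN hN1 hRX hM hβX hc hcK hsi hi
    have hrnn : 0 ≤ c * N s * ρX s / ρX i := div_nonneg (mul_nonneg (mul_nonneg hc (hN s).le) (hρX s).le) (hρX i).le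
    rcases le_or_gt 0 (βX i) with hu | hu
    · exact add_nonneg (pow_nonneg hu n) (mul_nonneg hrnn hHnn)
    · rcases Nat.even_or_odd n with he | ho
      · exact add_nonneg (he.pow_nonneg _) (mul_nonneg hrnn hHnn)
      · have hau : -βX i ≤ a i := by
          have : c ≤ a i := by linarith [perStep_level hN hM ha hc hcK h3 (le_refl i)]
          have hβge := hubClass_beta_ge hρX hmonoX hN hRX hM hβX hc hi
          nlinarith
        have hHge := cover_H_ge_pow hH ho (by linarith : 0 ≤ -βX i) hau hapos
        rw [neg_neg] at hHge
        have hn1 : n - 1 + 1 = n := by obtain ⟨k, hk⟩ := ho; omega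
        have hun : βX i ^ n = -((-βX i) * (-βX i) ^ (n - 1)) := by
          rw [← pow_succ', hn1, ho.neg_pow]; ring
        rw [hun]
        have h1 : (-βX i) * (-βX i) ^ (n - 1) ≤ (c * N s * ρX s / ρX i) * (-βX i) ^ (n - 1) :=
          mul_le_mul_of_nonneg_right (by linarith) (pow_nonneg (by linarith) _)
        have h2 : (c * N s * ρX s / ρX i) * (-βX i) ^ (n - 1) ≤ (c * N s * ρX s / ρX i) * H n (βX i) (a i) := mul_le_mul_of_nonneg_left hHge hrnn
        linarith
  have hcN : 0 ≤ c * N i * (H n (βX i) (a i) - H n (βY i) (a i)) := mul_nonneg (mul_nonneg hc (hN i).le) (by linarith)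
  nlinarith [hA, hB, hC, hcN]

/-- **(II):** `P_Yⁿ(s,i) ≤ P_Xⁿ(s,i) + P_Xⁿ(s,s)` for `s < i` (M′ from the tag start plus non-negativity). [ours] -/
theorem cover_II (hρX : ∀ i, 0 < ρX i) (hmonoX : Monotone ρX) (hρY : ∀ i, 0 < ρY i) (hmonoY : Monotone ρY)
    (hagree : ∀ i, i ≠ s → ρX i = ρY i) (htag : ρX s ≤ ρY s) (hN : ∀ i, 0 < N i) (hN1 : ∀ i, 1 ≤ N i)
    (hRX : ∀ k, RX k = ∑ i ∈ range k, N i * ρX i) (hRY : ∀ k, RY k = ∑ i ∈ range k, N i * ρY i) (hM : ∀ k, M k = ∑ i ∈ Ico k m, N i)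
    (hPXoff : ∀ i j, i ≠ j → PX i j = c * N j * min 1 (ρX j / ρX i)) (hPXdiag : ∀ i, PX i i = 1 - ∑ j ∈ (range m).erase i, PX i j)
    (hPYoff : ∀ i j, i ≠ j → PY i j = c * N j * min 1 (ρY j / ρY i)) (hPYdiag : ∀ i, PY i i = 1 - ∑ j ∈ (range m).erase i, PY i j)
    (hfX : ∀ k i, fX k i = if i < k then ρX k else if i = k then -(RX k / N k) else 0)
    (hfY : ∀ k i, fY k i = if i < k then ρY k else if i = k then -(RY k / N k) else 0)
    (hβX : ∀ k, βX k = 1 - c * (M k + RX k / ρX k)) (hβY : ∀ k, βY k = 1 - c * (M k + RY k / ρY k)) (ha : ∀ l, a l = 1 - c * M (l + 1))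
    (hPX0 : ∀ i j, PnX 0 i j = if i = j then 1 else 0) (hPXs : ∀ n i j, PnX (n + 1) i j = ∑ l ∈ range m, PnX n i l * PX l j)
    (hPY0 : ∀ i j, PnY 0 i j = if i = j then 1 else 0) (hPYs : ∀ n i j, PnY (n + 1) i j = ∑ l ∈ range m, PnY n i l * PY l j)
    (hTX : ∀ n j, TX n j = (1 - βX j ^ n) / RX m + ∑ k ∈ Ico (j + 1) m, (1 / RX k - 1 / RX (k + 1)) * (βX k ^ n - βX j ^ n))
    (hTY : ∀ n j, TY n j = (1 - βY j ^ n) / RY m + ∑ k ∈ Ico (j + 1) m, (1 / RY k - 1 / RY (k + 1)) * (βY k ^ n - βY j ^ n))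
    (hc : 0 ≤ c) (hcK : c * M 0 ≤ 1 + c) (n : ℕ) {i : ℕ} (hsi : s < i) (hi : i < m) (h3 : M (i + 1) + 3 ≤ M 0) :
    PnY n s i ≤ PnX n s i + PnX n s s := by
  have hs : s < m := hsi.trans hi
  have hnn := cover_pow_nonneg hPX0 hPXs (fun l hl j => cover_P_nonneg hρX hmonoX hN hN1 hRX hM hPXoff hPXdiag hβX hc hcK hl j) n s s
  rw [hubClass_pow_offdiag hρY hmonoY hN hRY hM hPYoff hPYdiag hfY hβY hPY0 hPYs hTY n hs hi (by omega),
    hubClass_pow_offdiag hρX hmonoX hN hRX hM hPXoff hPXdiag hfX hβX hPX0 hPXs hTX n hs hi (by omega), max_eq_right hsi.le, ← hagree i (by omega)]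
  have hT := perStep_T_le_deep hρX hρY hmonoY hagree htag hN hRX hRY hM hβX hβY ha hTX hTY hc hcK n hsi hi h3
  nlinarith [mul_le_mul_of_nonneg_left hT (mul_nonneg (hN i).le (hρX i).le)]

/-- The one-step rows at the start class: `P_X(i,l) = P_Y(i,l)` off `{i,s}`, and `P_X(i,i) − P_Y(i,i) = P_Y(i,s) − P_X(i,s) ≥ 0`. [ours] -/
theorem cover_diag_gap (hρX : ∀ i, 0 < ρX i) (hagree : ∀ i, i ≠ s → ρX i = ρY i) (htag : ρX s ≤ ρY s) (hN : ∀ i, 0 < N i)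
    (hPXoff : ∀ i j, i ≠ j → PX i j = c * N j * min 1 (ρX j / ρX i)) (hPXdiag : ∀ i, PX i i = 1 - ∑ j ∈ (range m).erase i, PX i j)
    (hPYoff : ∀ i j, i ≠ j → PY i j = c * N j * min 1 (ρY j / ρY i)) (hPYdiag : ∀ i, PY i i = 1 - ∑ j ∈ (range m).erase i, PY i j)
    (hc : 0 ≤ c) {i : ℕ} (his : i ≠ s) (hs : s < m) :
    (∀ l, l ≠ i → l ≠ s → PX i l = PY i l) ∧ PX i i - PY i i = PY i s - PX i s ∧ 0 ≤ PY i s - PX i s := by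
  have hoff : ∀ l, l ≠ i → l ≠ s → PX i l = PY i l := fun l hli hls => by
    rw [hPXoff i l (Ne.symm hli), hPYoff i l (Ne.symm hli), hagree l hls, hagree i his]
  refine ⟨hoff, ?_, ?_⟩
  · rw [hPXdiag, hPYdiag, ← Finset.add_sum_erase _ _ (mem_erase.mpr ⟨Ne.symm his, mem_range.mpr hs⟩),
      ← Finset.add_sum_erase ((range m).erase i) _ (mem_erase.mpr ⟨Ne.symm his, mem_range.mpr hs⟩)]
    have : ∑ x ∈ ((range m).erase i).erase s, PX i x = ∑ x ∈ ((range m).erase i).erase s, PY i x :=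
      sum_congr rfl fun l hl => hoff l (ne_of_mem_erase (mem_of_mem_erase hl)) (ne_of_mem_erase hl)
    rw [this]; ring
  · rw [hPXoff i s his, hPYoff i s his, ← hagree i his]
    have h : min 1 (ρX s / ρX i) ≤ min 1 (ρY s / ρX i) := min_le_min le_rfl (div_le_div_of_nonneg_right htag (hρX i).le)
    nlinarith [mul_nonneg hc (hN s).le]

end CoverEst
/-! ### §3 The cover, by induction on the number of attempts -/
section Cover
variable {m s : ℕ} {ρX ρY N RX RY M βX βY a : ℕ → ℝ} {c : ℝ} {PX PY fX fY : ℕ → ℕ → ℝ} {PnX PnY : ℕ → ℕ → ℕ → ℝ} {TX TY : ℕ → ℕ → ℝ}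

/-- **The induction, abstractly:** per-step domination from every other ordinary start to the start class `i` (M′), the two tag estimates `(I)`, `(II)`, and the kernel rows
give `P_Yⁿ(i,i) ≤ P_Xⁿ(i,i) + P_Xⁿ(i,s)` for every `n`. [ours] -/
theorem startClass_cover_of (hρX : ∀ i, 0 < ρX i) (hmonoX : Monotone ρX) (hρY : ∀ i, 0 < ρY i) (hmonoY : Monotone ρY)
    (hagree : ∀ i, i ≠ s → ρX i = ρY i) (htag : ρX s ≤ ρY s) (hN : ∀ i, 0 < N i) (hN1 : ∀ i, 1 ≤ N i)
    (hRX : ∀ k, RX k = ∑ i ∈ range k, N i * ρX i) (hRY : ∀ k, RY k = ∑ i ∈ range k, N i * ρY i) (hM : ∀ k, M k = ∑ i ∈ Ico k m, N i)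
    (hPXoff : ∀ i j, i ≠ j → PX i j = c * N j * min 1 (ρX j / ρX i)) (hPXdiag : ∀ i, PX i i = 1 - ∑ j ∈ (range m).erase i, PX i j)
    (hPYoff : ∀ i j, i ≠ j → PY i j = c * N j * min 1 (ρY j / ρY i)) (hPYdiag : ∀ i, PY i i = 1 - ∑ j ∈ (range m).erase i, PY i j)
    (hβX : ∀ k, βX k = 1 - c * (M k + RX k / ρX k)) (hβY : ∀ k, βY k = 1 - c * (M k + RY k / ρY k))
    (hPX0 : ∀ i j, PnX 0 i j = if i = j then 1 else 0) (hPXs : ∀ n i j, PnX (n + 1) i j = ∑ l ∈ range m, PnX n i l * PX l j)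
    (hPY0 : ∀ i j, PnY 0 i j = if i = j then 1 else 0) (hPYs : ∀ n i j, PnY (n + 1) i j = ∑ l ∈ range m, PnY n i l * PY l j)
    (hc : 0 ≤ c) (hcK : c * M 0 ≤ 1 + c) {i : ℕ} (his : i ≠ s) (hi : i < m) (hs : s < m)
    (hM' : ∀ n l, l < m → l ≠ i → l ≠ s → PnY n l i ≤ PnX n l i)
    (hI : ∀ n, PnY n s i ≤ PnX n i i + PnX n i s) (hII : ∀ n, PnY n s i ≤ PnX n s i + PnX n s s) :
    ∀ n, PnY n i i ≤ PnX n i i + PnX n i s := by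
  have hPXnn : ∀ l, l < m → ∀ j, 0 ≤ PX l j := fun l hl j => cover_P_nonneg hρX hmonoX hN hN1 hRX hM hPXoff hPXdiag hβX hc hcK hl j
  have hPYnn : ∀ l, l < m → ∀ j, 0 ≤ PY l j := fun l hl j => cover_P_nonneg hρY hmonoY hN hN1 hRY hM hPYoff hPYdiag hβY hc hcK hl j
  have hXnn := cover_pow_nonneg hPX0 hPXs hPXnn
  obtain ⟨hrow, hdiag, hd⟩ := cover_diag_gap hρX hagree htag hN hPXoff hPXdiag hPYoff hPYdiag hc his hs
  intro n
  induction n with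
  | zero => rw [hPY0, hPX0, hPX0, if_pos rfl, if_neg his]; norm_num
  | succ n ih =>
      rw [cover_pow_left hPY0 hPYs n hi hi, cover_pow_left hPX0 hPXs n hi hi, cover_pow_left hPX0 hPXs n hi hs]
      have hmem_i : i ∈ range m := mem_range.mpr hi
      have hmem_s : s ∈ (range m).erase i := mem_erase.mpr ⟨Ne.symm his, mem_range.mpr hs⟩
      have split : ∀ g : ℕ → ℝ, ∑ l ∈ range m, g l = g i + g s + ∑ l ∈ ((range m).erase i).erase s, g l := by
        intro g; rw [← Finset.add_sum_erase _ _ hmem_i, ← Finset.add_sum_erase _ _ hmem_s]; ring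
      rw [split (fun l => PY i l * PnY n l i), split (fun l => PX i l * PnX n l i), split (fun l => PX i l * PnX n l s)]
      have hrest : ∑ l ∈ ((range m).erase i).erase s, PY i l * PnY n l i ≤ ∑ l ∈ ((range m).erase i).erase s, (PX i l * PnX n l i + PX i l * PnX n l s) := by
        refine sum_le_sum fun l hl => ?_
        have hls : l ≠ s := ne_of_mem_erase hl
        have hli : l ≠ i := ne_of_mem_erase (mem_of_mem_erase hl)
        have hlm : l < m := mem_range.mp (mem_of_mem_erase (mem_of_mem_erase hl))
        rw [← hrow l hli hls]
        have hPil : 0 ≤ PX i l := hPXnn i hi l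
        nlinarith [mul_le_mul_of_nonneg_left (hM' n l hlm hli hls) hPil, mul_nonneg hPil (hXnn n l s)]
      rw [sum_add_distrib] at hrest
      have hPYii : 0 ≤ PY i i := hPYnn i hi i
      have hPXis : 0 ≤ PX i s := hPXnn i hi s
      have k1 := mul_le_mul_of_nonneg_left ih hPYii
      have k2 := mul_le_mul_of_nonneg_left (hI n) hd
      have k3 := mul_le_mul_of_nonneg_left (hII n) hPXis
      have eqX : PX i i * PnX n i i + PX i s * PnX n s i + ∑ l ∈ ((range m).erase i).erase s, PX i l * PnX n l i
            + (PX i i * PnX n i s + PX i s * PnX n s s + ∑ l ∈ ((range m).erase i).erase s, PX i l * PnX n l s)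
          = PY i i * (PnX n i i + PnX n i s) + (PY i s - PX i s) * (PnX n i i + PnX n i s) + PX i s * (PnX n s i + PnX n s s)
            + (∑ l ∈ ((range m).erase i).erase s, PX i l * PnX n l i + ∑ l ∈ ((range m).erase i).erase s, PX i l * PnX n l s) := by
        have e1 : PX i i = PY i i + (PY i s - PX i s) := by linarith
        rw [e1]; ring
      have eqY : PY i s * PnY n s i = PX i s * PnY n s i + (PY i s - PX i s) * PnY n s i := by ring
      linarith [k1, k2, k3, hrest, eqX, eqY]

/-- **THE START-CLASS DEFICIT IS COVERED BY THE TAG'S OCCUPATION, STEP BY STEP:** for a start class `i` deeper than the tag (`s < i < m`, three particles at ranks `≤ i`, `N ≥ 1`,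
`cM_0 ≤ 1 + c`): `P_Yⁿ(i,i) ≤ P_Xⁿ(i,i) + P_Xⁿ(i,s)` for every `n`. [ours] -/
theorem startClass_cover (hρX : ∀ i, 0 < ρX i) (hmonoX : Monotone ρX) (hρY : ∀ i, 0 < ρY i) (hmonoY : Monotone ρY)
    (hagree : ∀ i, i ≠ s → ρX i = ρY i) (htag : ρX s ≤ ρY s) (hN : ∀ i, 0 < N i) (hN1 : ∀ i, 1 ≤ N i)
    (hRX : ∀ k, RX k = ∑ i ∈ range k, N i * ρX i) (hRY : ∀ k, RY k = ∑ i ∈ range k, N i * ρY i) (hM : ∀ k, M k = ∑ i ∈ Ico k m, N i)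
    (hPXoff : ∀ i j, i ≠ j → PX i j = c * N j * min 1 (ρX j / ρX i)) (hPXdiag : ∀ i, PX i i = 1 - ∑ j ∈ (range m).erase i, PX i j)
    (hPYoff : ∀ i j, i ≠ j → PY i j = c * N j * min 1 (ρY j / ρY i)) (hPYdiag : ∀ i, PY i i = 1 - ∑ j ∈ (range m).erase i, PY i j)
    (hfX : ∀ k i, fX k i = if i < k then ρX k else if i = k then -(RX k / N k) else 0)
    (hfY : ∀ k i, fY k i = if i < k then ρY k else if i = k then -(RY k / N k) else 0)
    (hβX : ∀ k, βX k = 1 - c * (M k + RX k / ρX k)) (hβY : ∀ k, βY k = 1 - c * (M k + RY k / ρY k)) (ha : ∀ l, a l = 1 - c * M (l + 1))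
    (hPX0 : ∀ i j, PnX 0 i j = if i = j then 1 else 0) (hPXs : ∀ n i j, PnX (n + 1) i j = ∑ l ∈ range m, PnX n i l * PX l j)
    (hPY0 : ∀ i j, PnY 0 i j = if i = j then 1 else 0) (hPYs : ∀ n i j, PnY (n + 1) i j = ∑ l ∈ range m, PnY n i l * PY l j)
    (hTX : ∀ n j, TX n j = (1 - βX j ^ n) / RX m + ∑ k ∈ Ico (j + 1) m, (1 / RX k - 1 / RX (k + 1)) * (βX k ^ n - βX j ^ n))
    (hTY : ∀ n j, TY n j = (1 - βY j ^ n) / RY m + ∑ k ∈ Ico (j + 1) m, (1 / RY k - 1 / RY (k + 1)) * (βY k ^ n - βY j ^ n))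
    (hc : 0 ≤ c) (hcK : c * M 0 ≤ 1 + c) {i : ℕ} (hsi : s < i) (hi : i < m) (h3 : M (i + 1) + 3 ≤ M 0) :
    ∀ n, PnY n i i ≤ PnX n i i + PnX n i s := by
  have hs : s < m := hsi.trans hi
  refine startClass_cover_of hρX hmonoX hρY hmonoY hagree htag hN hN1 hRX hRY hM hPXoff hPXdiag hPYoff hPYdiag hβX hβY hPX0 hPXs hPY0 hPYs hc hcK (by omega) hi hs
    ?_ ?_ ?_
  · intro n l hl hli hls
    refine perStep_pow_le hρX hmonoX hρY hmonoY hagree htag hN hRX hRY hM hPXoff hPXdiag hPYoff hPYdiag hfX hfY hβX hβY ha hPX0 hPXs hPY0 hPYs hTX hTY hc hcK n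
      hl hi hs hli hls (by omega) ?_
    have hmax : M (max (max l i) s + 1) ≤ M (i + 1) := by
      refine perStep_M_anti hN hM ?_
      have : i ≤ max (max l i) s := (le_max_right _ _).trans (le_max_left _ _)
      omega
    linarith
  · exact fun n => cover_I hρX hmonoX hρY hmonoY hagree htag hN hN1 hRX hRY hM hPXoff hPXdiag hPYoff hPYdiag hfX hfY hβX hβY ha hPX0 hPXs hPY0 hPYs hTX hTY hc hcK n hsi hi h3
  · exact fun n => cover_II hρX hmonoX hρY hmonoY hagree htag hN hN1 hRX hRY hM hPXoff hPXdiag hPYoff hPYdiag hfX hfY hβX hβY ha hPX0 hPXs hPY0 hPYs hTX hTY hc hcK n hsi hi h3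

end Cover

end Summit.Ventures.LatticeQCDFlow.Scaling
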